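import Summits.ABC.IUTFork.Charitable.Thm311D4
import Summits.ABC.IUTFork.Charitable.Thm311D4DeriveKit
import Summits.ABC.IUTFork.Charitable.Thm311D4Derive
import Mathlib.GroupTheory.OrderOfElement
import HarnessLib

/-!
# [IUTchIII] Theorem 3.11, team D4's charitable re-typing — the printed HEDGES run on the decisive clause (L) (`Thm311D4Slack`)

Companion (D-0012; abc-iut cell, block D team D4, seat abc-iut-D4-typ, gen 2) of `Charitable/Thm311D4.lean` (p433089, DEFS-FROZEN; not
edited, not restated). TAKES NO SIDE on [IUTchIII] Cor. 3.12. NO `Prop` FACT: the new clauses below are READING PREDICATES (`def … :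
Prop` with print locators), never asserted, never sorried; the theorems are kernel bookkeeping between readings. Source as in p433089:
S. Mochizuki, *Inter-universal Teichmüller theory III*, kurims manuscript (May 2020) = `paper:url-4b091feeb646`, render
`HOME/lit/renders/IUTchIII-kurims-url-4b091feeb646/p0NNN.txt`. [claim: Mochizuki2012, status: disputed]

PURPOSE — (c)-aid for the block-D referees. Team D4 derived S from `Thm311Charitable_4` (abc-iut-D4-prv, p433392) consuming, beyond the
frozen (i)/(ii), exactly the charitable clause (L) `D4.LinkKummerCompat`. The D referees rule whether (L) is FAITHFUL or
STRONGER-THAN-PRINT; referee 3's PRE-REGISTERED rubric (HOME/plan/D-ref-3/PROTOCOL.md §3, filed before any typing was read) names the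
tests a datum-level transport law must survive to count as borne by the page. This file runs the three that are statable over the
frozen vocabulary IN KERNEL, so that the verdict can rest on theorems rather than on prose:

* §1 (α) the μ-ORBIT SLACK of Rmk. 3.11.4 (i) (p. 171 l. 21–27: «multiplication of the data considered in Theorem 3.11, (ii), (b), (c),
  by roots of unity must be “identified” with the identity automorphism. Put another way, this data … may only be considered up to
  multiplication by roots of unity. Thus, for instance, it only makes sense to consider orbits of this data relative to multiplication by
  roots of unity [i.e., as opposed to specific elements within such orbits]»). Typed: (L^μ) `LinkKummerCompatModRoots` = (L) with BOTH
  pilot Kummer images read only up to the action of roots of unity of their lines' splitting monoids (the action being the frozen field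
  `MRData.act`, the one trace of the monoid law in the signature). KERNEL: `(L) → (L^μ)` always; `(L^μ) → (L)` under (ii)(b) and the
  TORSION-STABILITY of the monoids (`RootStable`, `QRootStable` — print: Prop. 3.5 (ii) (c), p. 105 l. 42–43: «the subgroup of units of “Ψ⊥”
  consists of the 2l-torsion subgroup of “Ψ”» [a monoid is stable under its own units]; Rmk. 3.11.4 (i), p. 171 l. 27–31 / l. 40–41:
  «This does not cause any problems in the case of the theta values … precisely because the theory … [is] invariant with respect to such
  indeterminacies [i.e., multiplication of the theta values by 2l-th roots of unity]», «the entire set — i.e., which, unlike specific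
  elements of this set, is stabilized by multiplication by roots of unity»). So (L), a statement about whole-monoid Kummer-image SETS,
  rigidifies no μ-orbit: granting the slack changes nothing, and S still follows (`s_of_charitable_4mu`).
* §2 (β) (Ind1), (Ind2)-EQUIVARIANCE: re-reading EITHER pilot's Kummer image through any further indeterminacy `Θ ∈ ⟨(Ind1) ∪ (Ind2)⟩`
  leaves (L) invariant (`linkKummerCompat_translate_iff`, `exists_transport_translate_iff`) — (L) «does not rigidify what (Ind1)/(Ind2)
  move».
* §3 (Ind3) AS AN UPPER BOUND («upper semi-compatible», (ii) p. 156 l. 33–38): the containment variant (L^⊆) `LinkKummerCompatUpper`, with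
  `(L) → (L^⊆)`. Whether (L^⊆) yields S is NOT claimed (containment-shaped clauses give hull-level licences, not the identification S —
  abc-iut-D4-prv's kit p432640, table row (K7)); recorded so the referee can see exactly where (L) exceeds the (Ind3)-hedged letter: in
  «=» versus «⊆», and nowhere else ((Ind3) moves the unit-group images of (ii)(a), `Column.unitImage`, never the splitting monoids, whose
  Kummer isomorphisms are «mutually compatible … to no indeterminacy!», p. 156 l. 19–25).
* §4 (T-c) for the μ-slackened reading: `Thm311Charitable_4mu ∧ PinnedRegions3` is satisfiable, contentfully (S and the typed
  Corollary hold there) — abc-iut-D4-prv's witness P♮ (p433392 `D4Derive.charitable_4_satisfiable_with_pins`) read through `(L) → (L^μ)`.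
Deliberately NOT here: any new model, any verdict on faithfulness (the referees'), any edit of p433089.
-/

noncomputable section

namespace Summit.ABC.IUTFork.Charitable.D4

open Thm311

variable {T : ThetaIndex}

/-! ## 0. Two set-algebra facts about the action of packet-automorphism families on `∏_{j ∈ 𝔽_l^⋇}` -/

section StarAut

variable (L : LogShells T)

/-- Acting by `Φ * Ψ` on a subset of `∏_{j ∈ 𝔽_l^⋇} 𝓘^ℚ(…)` is acting by `Ψ`, then by `Φ` (image form of `starAut_mul`). [folklore] -/
theorem starAut_mul_image (Φ Ψ : L.PacketAut) (v : T.V) (X : Set (L.StarPacket v)) :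
    L.starAut (Φ * Ψ) v '' X = L.starAut Φ v '' (L.starAut Ψ v '' X) := by
  rw [Set.image_image]; rfl

/-- Acting by `Φ⁻¹` undoes acting by `Φ` on subsets. [folklore] -/
theorem starAut_inv_image_image (Φ : L.PacketAut) (v : T.V) (X : Set (L.StarPacket v)) :
    L.starAut Φ⁻¹ v '' (L.starAut Φ v '' X) = X := by
  rw [← starAut_mul_image, inv_mul_cancel, LogShells.starAut_one]
  ext x
  simp

end StarAut

variable (S : LatticeSituation T) (Q : LinkKummerData S)

/-! ## 1. (α) «up to multiplication by roots of unity» — Rmk. 3.11.4 (i) -/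

/-- **Multiplication by roots of unity of the splitting monoid**, as seen on `∏_{j ∈ 𝔽_l^⋇} 𝓘^ℚ(^{S^±_{j+1},j};𝒟^⊢_v)` through the
[multiplicative] action of (i) (b) (p. 153 l. 44 – p. 154 l. 11: «the splitting monoid … as a subset of ∏ … equipped with a(n)
[multiplicative] action on ∏ …» = the frozen field `MRData.act`, the only trace of the monoid law in the signature): the identity, or the action of an
element `ζ` of the monoid `Ψ` whose action has FINITE ORDER — print's «2l-th roots of unity» (Rmk. 3.11.4 (i), p. 171 l. 30), the
units of `Ψ⊥` (Prop. 3.5 (ii) (c), p. 105 l. 42–43: «the subgroup of units of “Ψ⊥” consists of the 2l-torsion subgroup of “Ψ”»). A SET of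
linear endomorphisms of the star packet. [claim: Mochizuki2012, status: disputed] -/
def rootActs {L : LogShells T} (D : MRData L) (v : T.V) (hv : v ∈ T.Vbad) : Set (Module.End ℚ (L.StarPacket v)) :=
  insert 1 {u | ∃ ζ ∈ D.Ψ v hv, IsOfFinOrder (D.act v hv ζ) ∧ u = D.act v hv ζ}

/-- The identity is (multiplication by) a root of unity. [folklore] -/
theorem one_mem_rootActs {L : LogShells T} (D : MRData L) (v : T.V) (hv : v ∈ T.Vbad) : (1 : Module.End ℚ _) ∈ rootActs D v hv :=
  Set.mem_insert _ _

/-- The identity endomorphism fixes every subset. [folklore] -/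
theorem end_one_image {M : Type*} [AddCommGroup M] [Module ℚ M] (X : Set M) : (⇑(1 : Module.End ℚ M)) '' X = X := by
  have h : (⇑(1 : Module.End ℚ M)) = id := rfl
  rw [h, Set.image_id]

/-- **`RootStable D` — the splitting monoid is stable under multiplication by its roots of unity** (Prop. 3.5 (ii) (c), p. 105 l. 42–43:
the units of `Ψ⊥_v` ARE its 2l-torsion, and a monoid is carried onto itself by multiplication by any of its units; Rmk. 3.11.4 (i),
p. 171 l. 27–31: «This does not cause any problems in the case of the theta values considered in Theorem 3.11, (ii), (b), precisely because the
theory developed so far was formulated precisely in such a way as to be invariant with respect to such indeterminacies [i.e.,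
multiplication of the theta values by 2l-th roots of unity …]»). A condition on INSTANTIATION of the frozen data (i) (b); READING
PREDICATE, never asserted. [claim: Mochizuki2012, status: disputed] -/
@[claim "Mochizuki2012" "disputed"]
def RootStable {L : LogShells T} (D : MRData L) : Prop :=
  ∀ (v : T.V) (hv : v ∈ T.Vbad), ∀ u ∈ rootActs D v hv, (⇑u) '' D.Ψ v hv = D.Ψ v hv

/-- **`QRootStable S Q` — the q-pilot's splitting monoid (the `q_v^ℕ` with its torsion, Def. 3.8 (i) p. 112 l. 48–55 «generators up to
torsion of the splitting monoid») is stable under multiplication by the roots of unity of its line** (same print as `RootStable`, for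
the codomain strip's monoid). READING PREDICATE, never asserted. [claim: Mochizuki2012, status: disputed] -/
@[claim "Mochizuki2012" "disputed"]
def QRootStable : Prop :=
  ∀ (n m : ℤ) (v : T.V) (hv : v ∈ T.Vbad), ∀ u ∈ rootActs (S.D n) v hv, (⇑u) '' Q.qΨ n m v hv = Q.qΨ n m v hv

/-- **(L^μ) `LinkKummerCompatModRoots` — the decisive clause (L) of p433089 with the μ-ORBIT SLACK of Rmk. 3.11.4 (i) GRANTED ON BOTH
SIDES** (p. 171 l. 23–27: «this data of Theorem 3.11, (ii), (b), (c), may only be considered up to multiplication by roots of unity.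
Thus, for instance, it only makes sense to consider orbits of this data relative to multiplication by roots of unity [i.e., as opposed to
specific elements within such orbits]»): across the arrow `(n−1, m) → (n, m)`, the codomain strip's pilot Kummer image `qΨ n m`, READ UP
TO multiplication by a root of unity of line `n`, is the translate by ONE `Φ ∈ ⟨(Ind1) ∪ (Ind2)⟩` of the domain strip's pilot Kummer image
`(S.col (n−1)).frobΨ m′`, READ UP TO multiplication by a root of unity of line `n−1`, for SOME `m′`. The weakest form of (L) the hedge
can ask for at the level of the frozen vocabulary. READING PREDICATE, never asserted. [claim: Mochizuki2012, status: disputed] -/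
@[claim "Mochizuki2012" "disputed"]
def LinkKummerCompatModRoots : Prop :=
  ∀ n m : ℤ, ∃ Φ ∈ Subgroup.closure (S.L.Ind1Family ∪ S.L.Ind2Family), ∃ m' : ℤ,
    ∀ (v : T.V) (hv : v ∈ T.Vbad), ∃ u ∈ rootActs (S.D (n - 1)) v hv, ∃ u' ∈ rootActs (S.D n) v hv,
      (⇑u') '' Q.qΨ n m v hv = S.L.starAut Φ v '' ((⇑u) '' (S.col (n - 1)).frobΨ m' v hv)

variable {S Q}

/-- (L) implies its μ-slackened form (take both roots of unity trivial). [claim: Mochizuki2012, status: disputed] -/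
theorem modRoots_of_linkKummerCompat (h : LinkKummerCompat S Q) : LinkKummerCompatModRoots S Q := by
  intro n m
  obtain ⟨Φ, hΦ, m', hm'⟩ := h n m
  refine ⟨Φ, hΦ, m', fun v hv => ⟨1, one_mem_rootActs _ v hv, 1, one_mem_rootActs _ v hv, ?_⟩⟩
  rw [end_one_image, end_one_image, hm' v hv]

/-- **The μ-slack is immaterial for (L).** Under (ii) (b) for every column and torsion-stability of the splitting monoids of both
lines, (L^μ) gives back (L): both sides of (L) are whole-monoid Kummer-image SETS, and such sets are their own μ-orbits («the entire set
… is stabilized by multiplication by roots of unity», Rmk. 3.11.4 (i) p. 171 l. 40–41). [claim: Mochizuki2012, status: disputed] -/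
theorem linkKummerCompat_of_modRoots (hB : ∀ n : ℤ, (S.col n).KummerB (S.D n)) (hR : ∀ n : ℤ, RootStable (S.D n))
    (hQ : QRootStable S Q) (h : LinkKummerCompatModRoots S Q) : LinkKummerCompat S Q := by
  intro n m
  obtain ⟨Φ, hΦ, m', hm'⟩ := h n m
  refine ⟨Φ, hΦ, m', fun v hv => ?_⟩
  obtain ⟨u, hu, u', hu', heq⟩ := hm' v hv
  rw [hQ n m v hv u' hu'] at heq
  rw [heq, hB (n - 1) m' v hv, hR (n - 1) v hv u hu]

/-- **(α) decided**: under (ii) (b) and torsion-stability, (L) ⟺ (L^μ). [claim: Mochizuki2012, status: disputed] -/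
theorem linkKummerCompat_iff_modRoots (hB : ∀ n : ℤ, (S.col n).KummerB (S.D n)) (hR : ∀ n : ℤ, RootStable (S.D n))
    (hQ : QRootStable S Q) : LinkKummerCompat S Q ↔ LinkKummerCompatModRoots S Q :=
  ⟨modRoots_of_linkKummerCompat, linkKummerCompat_of_modRoots hB hR hQ⟩

variable (S Q)

/-- **`Thm311Charitable_4mu`** — team D4's charitable reading with the decisive clause μ-SLACKENED: `Thm311Literal_4 ∧ QKummerCoric ∧
LinkKummerCompatModRoots` (cf. `D4.charitable_iff_literal_and`: `Thm311Charitable_4 ↔ Thm311Literal_4 ∧ QKummerCoric ∧ LinkKummerCompat`).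
READING PREDICATE, never asserted. [claim: Mochizuki2012, status: disputed] -/
@[claim "Mochizuki2012" "disputed"]
def Thm311Charitable_4mu : Prop := Thm311Literal_4 S Q ∧ QKummerCoric S Q ∧ LinkKummerCompatModRoots S Q

variable {S Q}

/-- The charitable reading implies its μ-slackened form. [claim: Mochizuki2012, status: disputed] -/
theorem charitable_4mu_of_charitable_4 (h : Thm311Charitable_4 S Q) : Thm311Charitable_4mu S Q := by
  obtain ⟨hlit, hq, hL⟩ := charitable_iff_literal_and.1 h
  exact ⟨hlit, hq, modRoots_of_linkKummerCompat hL⟩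

/-- Under torsion-stability the μ-slackened reading gives back the charitable reading ((ii) (b) is inside `Thm311Literal_4`).
[claim: Mochizuki2012, status: disputed] -/
theorem charitable_4_of_charitable_4mu (h : Thm311Charitable_4mu S Q) (hR : ∀ n : ℤ, RootStable (S.D n)) (hQ : QRootStable S Q) :
    Thm311Charitable_4 S Q := by
  obtain ⟨hlit, hq, hL⟩ := h
  exact charitable_iff_literal_and.2 ⟨hlit, hq, linkKummerCompat_of_modRoots (fun n => (hlit.2.1 n).2.1) hR hQ hL⟩

/-- Under torsion-stability: `Thm311Charitable_4mu ↔ Thm311Charitable_4`. [claim: Mochizuki2012, status: disputed] -/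
theorem charitable_4mu_iff (hR : ∀ n : ℤ, RootStable (S.D n)) (hQ : QRootStable S Q) :
    Thm311Charitable_4mu S Q ↔ Thm311Charitable_4 S Q :=
  ⟨fun h => charitable_4_of_charitable_4mu h hR hQ, charitable_4mu_of_charitable_4⟩

/-- **S survives the μ-slack.** For a Cor.-3.12 setting `P` over `S` at column `n`, any region operator `ρ`, and the pins' q-datum read as
`Q.qΨ P.n m₁` (as in abc-iut-D4-prv's `D4Derive.s_of_charitable_4`): the μ-slackened charitable reading together with torsion-stability of the
splitting monoids yields the residual `Cor312Vol.PilotKummerIndRelated` — by kit (K2) `D4Derive.pilotKummerIndRelated_of_transportAt` at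
column `n − 1` (pins not consumed). [claim: Mochizuki2012, status: disputed] -/
theorem s_of_charitable_4mu (P : Cor312.Setting S.toSituation)
    (ρ : (∀ v : T.V, v ∈ T.Vbad → Set (S.L.StarPacket v)) → ∀ (j : T.Label) (vQ : T.VQ), Set (S.L.Packet j vQ)) (m₁ : ℤ)
    (h : Thm311Charitable_4mu S Q) (hR : ∀ n : ℤ, RootStable (S.D n)) (hQ : QRootStable S Q) :
    Summit.ABC.IUTFork.Cor312Vol.PilotKummerIndRelated S P ρ (Q.qΨ P.n m₁) := by
  have hc : Thm311Charitable_4 S Q := charitable_4_of_charitable_4mu h hR hQ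
  obtain ⟨Φ, hΦ, m', hm'⟩ := linkKummerCompat_of_charitable hc P.n m₁
  exact D4Derive.pilotKummerIndRelated_of_transportAt S P ρ (Q.qΨ P.n m₁) hc.1.2.2 (hc.2.1 (P.n - 1)).2.1 hΦ hm'

/-- The same with the three pins carried in the hypothesis (block-D (a)-shape: `reading ∧ PinnedRegions3 → S`). [claim: Mochizuki2012, status: disputed] -/
theorem s_of_charitable_4mu_pinned (P : Cor312.Setting S.toSituation)
    (ρ : (∀ v : T.V, v ∈ T.Vbad → Set (S.L.StarPacket v)) → ∀ (j : T.Label) (vQ : T.VQ), Set (S.L.Packet j vQ)) (m₁ : ℤ)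
    (h : (Thm311Charitable_4mu S Q ∧ (∀ n : ℤ, RootStable (S.D n)) ∧ QRootStable S Q) ∧
      Summit.ABC.IUTFork.Cor312Vol.PinnedRegions3 S P ρ (Q.qΨ P.n m₁)) :
    Summit.ABC.IUTFork.Cor312Vol.PilotKummerIndRelated S P ρ (Q.qΨ P.n m₁) :=
  s_of_charitable_4mu P ρ m₁ h.1.1 h.1.2.1 h.1.2.2

/-! ## 2. (β) (Ind1), (Ind2)-equivariance of (L): re-reading either pilot through a further indeterminacy -/

/-- Re-reading every q-pilot Kummer image through a further family of packet automorphisms `Θ n m` (an indeterminacy when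
`Θ n m ∈ ⟨(Ind1) ∪ (Ind2)⟩`): the link/Kummer data with `qΨ n m` replaced by its `Θ n m`-translate. DATA ONLY. [claim: Mochizuki2012, status: disputed] -/
def _root_.Summit.ABC.IUTFork.Charitable.D4.LinkKummerData.translate (Q : LinkKummerData S) (Θ : ℤ → ℤ → S.L.PacketAut) :
    LinkKummerData S where
  qΨ n m v hv := S.L.starAut (Θ n m) v '' Q.qΨ n m v hv
  linkΦ := Q.linkΦ
  stripΦ := Q.stripΦ

/-- **(β), codomain side.** (L) is invariant under re-reading the codomain strip's pilot Kummer images through ANY further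
indeterminacies `Θ n m ∈ ⟨(Ind1) ∪ (Ind2)⟩`: the clause quantifies `∃ Φ` over the whole subgroup, so it pins no representative of an
(Ind1), (Ind2)-orbit. [claim: Mochizuki2012, status: disputed] -/
theorem linkKummerCompat_translate_iff {Θ : ℤ → ℤ → S.L.PacketAut}
    (hΘ : ∀ n m : ℤ, Θ n m ∈ Subgroup.closure (S.L.Ind1Family ∪ S.L.Ind2Family)) :
    LinkKummerCompat S (Q.translate Θ) ↔ LinkKummerCompat S Q := by
  constructor
  · intro h n m
    obtain ⟨Φ, hΦ, m', hm'⟩ := h n m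
    refine ⟨(Θ n m)⁻¹ * Φ, Subgroup.mul_mem _ (Subgroup.inv_mem _ (hΘ n m)) hΦ, m', fun v hv => ?_⟩
    have h1 : S.L.starAut (Θ n m) v '' Q.qΨ n m v hv = S.L.starAut Φ v '' (S.col (n - 1)).frobΨ m' v hv := hm' v hv
    rw [starAut_mul_image, ← h1, starAut_inv_image_image]
  · intro h n m
    obtain ⟨Φ, hΦ, m', hm'⟩ := h n m
    refine ⟨Θ n m * Φ, Subgroup.mul_mem _ (hΘ n m) hΦ, m', fun v hv => ?_⟩
    show S.L.starAut (Θ n m) v '' Q.qΨ n m v hv = _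
    rw [hm' v hv, starAut_mul_image]

/-- **(β), domain side.** Re-reading the domain strip's pilot Kummer image through a further indeterminacy `Θ ∈ ⟨(Ind1) ∪ (Ind2)⟩` does
not change whether a datum is an indeterminacy-translate of it. [claim: Mochizuki2012, status: disputed] -/
theorem exists_transport_translate_iff {v : T.V} (X Y : Set (S.L.StarPacket v)) {Θ : S.L.PacketAut}
    (hΘ : Θ ∈ Subgroup.closure (S.L.Ind1Family ∪ S.L.Ind2Family)) :
    (∃ Φ ∈ Subgroup.closure (S.L.Ind1Family ∪ S.L.Ind2Family), X = S.L.starAut Φ v '' (S.L.starAut Θ v '' Y)) ↔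
      ∃ Φ ∈ Subgroup.closure (S.L.Ind1Family ∪ S.L.Ind2Family), X = S.L.starAut Φ v '' Y := by
  constructor
  · rintro ⟨Φ, hΦ, h⟩
    exact ⟨Φ * Θ, Subgroup.mul_mem _ hΦ hΘ, by rw [h, starAut_mul_image]⟩
  · rintro ⟨Φ, hΦ, h⟩
    refine ⟨Φ * Θ⁻¹, Subgroup.mul_mem _ hΦ (Subgroup.inv_mem _ hΘ), ?_⟩
    rw [h, ← starAut_mul_image, mul_assoc, inv_mul_cancel, mul_one]

/-- (β) for the whole reading: translating the q-pilot Kummer images by indeterminacies that do not depend on the vertical coordinate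
leaves `Thm311Charitable_4` invariant ((Q′) `QKummerCoric` is preserved by `m`-independent translates; (iii) (a)(b), (c)(d)-literal and
(d)-final do not read `qΨ`). [claim: Mochizuki2012, status: disputed] -/
theorem charitable_4_translate_iff {Θ : ℤ → ℤ → S.L.PacketAut}
    (hΘ : ∀ n m : ℤ, Θ n m ∈ Subgroup.closure (S.L.Ind1Family ∪ S.L.Ind2Family)) (hΘm : ∀ n m m' : ℤ, Θ n m = Θ n m') :
    Thm311Charitable_4 S (Q.translate Θ) ↔ Thm311Charitable_4 S Q := by
  have hq : QKummerCoric S (Q.translate Θ) ↔ QKummerCoric S Q := by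
    constructor
    · intro h n m m' v hv
      have h1 : S.L.starAut (Θ n m) v '' Q.qΨ n m v hv = S.L.starAut (Θ n m') v '' Q.qΨ n m' v hv := h n m m' v hv
      rw [hΘm n m m'] at h1
      rw [← starAut_inv_image_image S.L (Θ n m') v (Q.qΨ n m v hv), h1, starAut_inv_image_image]
    · intro h n m m' v hv
      show S.L.starAut (Θ n m) v '' Q.qΨ n m v hv = S.L.starAut (Θ n m') v '' Q.qΨ n m' v hv
      rw [h n m m' v hv, hΘm n m m']
  rw [charitable_iff_literal_and, charitable_iff_literal_and, linkKummerCompat_translate_iff hΘ, hq]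
  exact Iff.rfl

/-! ## 3. (Ind3) as an upper bound: the containment variant of (L) -/

variable (S Q)

/-- **(L^⊆) `LinkKummerCompatUpper` — (L) with (Ind3) read as «upper semi-compatibility»** ((ii), p. 156 l. 33–38: «(Ind3) as one varies
m ∈ ℤ, the isomorphisms of (a) are “upper semi-compatible”, … in a sense that involves certain natural inclusions “⊆” …»): across the
arrow `(n−1, m) → (n, m)` the codomain strip's pilot Kummer image is CONTAINED in an (Ind1), (Ind2)-translate of the UNION over the
vertical coordinate of the domain strip's pilot Kummer images. The weakest, containment-only shape; (L) asserts «=» with one member of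
the union instead. READING PREDICATE, never asserted; whether it yields S is not claimed here (containment-shaped clauses give
hull-level licences — abc-iut-D4-prv's kit p432640, (K7)). [claim: Mochizuki2012, status: disputed] -/
@[claim "Mochizuki2012" "disputed"]
def LinkKummerCompatUpper : Prop :=
  ∀ n m : ℤ, ∃ Φ ∈ Subgroup.closure (S.L.Ind1Family ∪ S.L.Ind2Family),
    ∀ (v : T.V) (hv : v ∈ T.Vbad), Q.qΨ n m v hv ⊆ S.L.starAut Φ v '' ⋃ m' : ℤ, (S.col (n - 1)).frobΨ m' v hv

variable {S Q}

/-- (L) implies its containment variant. [claim: Mochizuki2012, status: disputed] -/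
theorem upper_of_linkKummerCompat (h : LinkKummerCompat S Q) : LinkKummerCompatUpper S Q := by
  intro n m
  obtain ⟨Φ, hΦ, m', hm'⟩ := h n m
  refine ⟨Φ, hΦ, fun v hv => ?_⟩
  rw [hm' v hv]
  exact Set.image_mono (Set.subset_iUnion (fun k : ℤ => (S.col (n - 1)).frobΨ k v hv) m')

/-- Under (ii) (b) the union over the vertical coordinate is the coric splitting monoid, so (L^⊆) reads: «`qΨ n m` lies inside an
indeterminacy-translate of `Ψ_{n−1}`» — (Ind3) has no effect on splitting monoids («mutually compatible … to no indeterminacy!», p. 156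
l. 19–25); what separates (L^⊆) from (L) is «⊆» versus «=» alone. [claim: Mochizuki2012, status: disputed] -/
theorem upper_iff_subset_coric (hB : ∀ n : ℤ, (S.col n).KummerB (S.D n)) :
    LinkKummerCompatUpper S Q ↔ ∀ n m : ℤ, ∃ Φ ∈ Subgroup.closure (S.L.Ind1Family ∪ S.L.Ind2Family),
      ∀ (v : T.V) (hv : v ∈ T.Vbad), Q.qΨ n m v hv ⊆ S.L.starAut Φ v '' (S.D (n - 1)).Ψ v hv := by
  have hU : ∀ (n : ℤ) (v : T.V) (hv : v ∈ T.Vbad), (⋃ m' : ℤ, (S.col (n - 1)).frobΨ m' v hv) = (S.D (n - 1)).Ψ v hv := by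
    intro n v hv
    have : (fun m' : ℤ => (S.col (n - 1)).frobΨ m' v hv) = fun _ => (S.D (n - 1)).Ψ v hv := funext fun m' => hB (n - 1) m' v hv
    rw [this, Set.iUnion_const]
  constructor
  · intro h n m
    obtain ⟨Φ, hΦ, hv⟩ := h n m
    exact ⟨Φ, hΦ, fun v hv' => by rw [← hU n v hv']; exact hv v hv'⟩
  · intro h n m
    obtain ⟨Φ, hΦ, hv⟩ := h n m
    exact ⟨Φ, hΦ, fun v hv' => by rw [hU n v hv']; exact hv v hv'⟩

/-! ## 4. (T-c) for the μ-slackened reading -/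

/-- **(T-c) `Thm311Charitable_4mu ∧ PinnedRegions3` is SATISFIABLE, contentfully**: abc-iut-D4-prv's witness (the natural model P♮ of
abc-iut-w5-d230: frozen typed Thm. 3.11 `F.Statement`, all bridge hypotheses, `|log(q)| > 0`, the three pins for `Q.qΨ P.n m₁`, S, and
the typed Corollary) satisfies the μ-slackened reading because it satisfies `Thm311Charitable_4` (`charitable_4mu_of_charitable_4`).
A consistency witness over a toy index; no side taken. [claim: Mochizuki2012, status: disputed] -/
theorem charitable_4mu_satisfiable_with_pins :
    ∃ (T' : ThetaIndex) (F : FullSituation T') (Q' : LinkKummerData F.toLatticeSituation)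
      (P : Cor312.Setting F.toLatticeSituation.toSituation)
      (ρ : (∀ v : T'.V, v ∈ T'.Vbad → Set (F.L.StarPacket v)) → ∀ (j : T'.Label) (vQ : T'.VQ), Set (F.L.Packet j vQ))
      (m₁ : ℤ),
      F.Statement ∧ Summit.ABC.IUTFork.Cor312Vol.BridgeHyps P ∧ P.AbsLogQPos ∧
        Thm311Charitable_4mu F.toLatticeSituation Q' ∧
        Summit.ABC.IUTFork.Cor312Vol.PinnedRegions3 F.toLatticeSituation P ρ (Q'.qΨ P.n m₁) ∧
        Summit.ABC.IUTFork.Cor312Vol.PilotKummerIndRelated F.toLatticeSituation P ρ (Q'.qΨ P.n m₁) ∧ P.Statement := by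
  obtain ⟨T', F, Q', P, ρ, m₁, h1, h2, h3, h4, h5, h6, h7, -, -⟩ := D4Derive.charitable_4_satisfiable_with_pins
  exact ⟨T', F, Q', P, ρ, m₁, h1, h2, h3, charitable_4mu_of_charitable_4 h4, h5, h6, h7⟩

end Summit.ABC.IUTFork.Charitable.D4

end
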